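import Summits.Ventures.HSemireg.EmbeddedFirstOrderDeformationsKSCoboundary

/-!
# Venture HSemireg — vector fields extend UNIQUELY to a localisation, so the Kodaira–Spencer statement of
# `…KSCoboundary` is a statement about the chart vector fields alone (the extensions are not extra data)

HONEST FRAMING.  Lean side of the computation cell `pub-hsemireg` (track «S4-PUSH» (ii), seat s4-prove-3 g6, second
route for (S5)); log `s4push/prove-3/ATTEMPT-10.md` §5f.  Plain commutative algebra (derivations, localisations, dual
numbers); no Mathlib scheme, sheaf, abelian variety or semiregularity map; nothing here says that HC, HC_CM or HC_AV
holds; no object is certified; no Literature fact is declared.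

WHAT (namespace `Summit.Ventures.HSemireg.EmbeddedDeformation`):
* §1 (any commutative ring `A`, any localisation `L` of `A` at a submonoid `M`, any derivation `D` of `A`):
  `derivationToHom D : A →+* L[ε]` (`a ↦ a/1 + ε(Da)/1`), **`Derivation.locLift D : Derivation ℤ L L`** — THE
  EXTENSION of `D` to `L` (`locLift_algebraMap : locLift D (a/1) = (D a)/1`), built as `z ↦ snd(h z)` for the ring
  map `h : L → L[ε]` extending `derivationToHom D` (`IsLocalization.lift`); and **`Derivation.eq_of_algebraMap`** —
  two derivations of `L` that agree on `A` are EQUAL (both give ring maps `L → L[ε]` over `id`, equal on `A`, hence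
  equal by `IsLocalization.ringHom_ext`), and `Derivation.eq_conjRingEquiv_locLift` (the same along `ψ ∘ (A → L)`
  for a ring automorphism `ψ` of `L`: `E = ψ_*(locLift D)`).  So «`E_α` extends `D_α`» in `…KSCoboundary` pins
  `E_α` down, on BOTH charts of the `(−2)`-atlas.
* §2 `thetaFamily_not_liftCoboundary_doubledLine` / `…_minusTwo` — the corollaries of `…KSCoboundary` restated
  with the extensions COMPUTED rather than assumed (`locLift`, and `Derivation.conjRingEquiv psi (locLift ·)` for the
  second chart of `𝒪_{ℙ¹}(−2)`): there are NO chart vector fields `D₀, D₁` with `E_α = E_β + θ_αβ` on the overlap.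

References: R. Hartshorne, *Deformation Theory*, GTM 257 (2010), §5 [corpus: book:springernd-deformation-theory];
extension of derivations to localisations is folklore (quotient rule).
-/

namespace Summit.Ventures.HSemireg

namespace EmbeddedDeformation

open DualNumber TrivSqZeroExt

universe u v

/-! ### §1 Derivations extend uniquely to localisations -/

section LocLift

variable {A : Type u} [CommRing A] (M : Submonoid A) (L : Type v) [CommRing L] [Algebra A L] [IsLocalization M L]

/-- `a ↦ a/1 + ε·(D a)/1 : A → L[ε]` is a ring map (Leibniz). [folklore] -/
noncomputable def derivationToHom (D : Derivation ℤ A A) : A →+* L[ε] where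
  toFun a := inl (algebraMap A L a) + inr (algebraMap A L (D a))
  map_one' := by
    ext
    · simp
    · simp
  map_mul' a b := by
    ext
    · simp [fst_add, fst_mul]
    · simp only [Derivation.leibniz, smul_eq_mul, map_add, map_mul, snd_add, snd_inl, snd_inr, zero_add,
        DualNumber.snd_mul, fst_add, fst_inl, fst_inr, add_zero]
      ring
  map_zero' := by
    ext
    · simp
    · simp
  map_add' a b := by
    ext
    · simp [fst_add]
    · simp only [map_add, snd_add, snd_inl, snd_inr, zero_add]

/-- Elements of `M` go to units of `L[ε]` (`m/1` is a unit and the `ε`-part is nilpotent). [folklore] -/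
theorem isUnit_derivationToHom (D : Derivation ℤ A A) (m : M) : IsUnit (derivationToHom L D m) := by
  rw [TrivSqZeroExt.isUnit_iff_isUnit_fst]
  change IsUnit ((inl (algebraMap A L (m : A)) + inr (algebraMap A L (D m)) : L[ε]).fst)
  rw [fst_add, fst_inl, fst_inr, add_zero]
  exact IsLocalization.map_units L m

include M in
/-- The extension `L → L[ε]` of `derivationToHom D`. [folklore] -/
noncomputable def derivationLiftHom (D : Derivation ℤ A A) : L →+* L[ε] :=
  IsLocalization.lift (M := M) (isUnit_derivationToHom M L D)

/-- `derivationLiftHom D (a/1) = derivationToHom D a`. [folklore] -/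
theorem derivationLiftHom_algebraMap (D : Derivation ℤ A A) (a : A) :
    derivationLiftHom M L D (algebraMap A L a) = derivationToHom L D a :=
  IsLocalization.lift_eq _ a

/-- `derivationLiftHom D` is a section of `fst`. [folklore] -/
theorem fst_derivationLiftHom (D : Derivation ℤ A A) (z : L) : (derivationLiftHom M L D z).fst = z := by
  have key : (fstRingHom L).comp (derivationLiftHom M L D) = RingHom.id L := by
    refine IsLocalization.ringHom_ext M (RingHom.ext fun a ↦ ?_)
    simp only [RingHom.comp_apply, RingHom.id_apply, derivationLiftHom_algebraMap, fstRingHom_apply]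
    change (inl (algebraMap A L a) + inr (algebraMap A L (D a)) : L[ε]).fst = _
    rw [fst_add, fst_inl, fst_inr, add_zero]
  simpa only [RingHom.comp_apply, fstRingHom_apply, RingHom.id_apply] using DFunLike.congr_fun key z

include M in
/-- **THE EXTENSION of a derivation `D` of `A` to the localisation `L`** (`z ↦ snd` of `derivationLiftHom D z`; the
quotient rule is hidden in the universal property). [folklore] -/
noncomputable def Derivation.locLift (D : Derivation ℤ A A) : Derivation ℤ L L :=
  Derivation.mk'
    { toFun := fun z ↦ (derivationLiftHom M L D z).snd
      map_add' := fun z w ↦ by simp only [map_add, snd_add]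
      map_smul' := fun n z ↦ by
        simp only [RingHom.id_apply]
        exact map_zsmul ((TrivSqZeroExt.sndHom L L).toAddMonoidHom.comp (derivationLiftHom M L D).toAddMonoidHom)
          n z }
    fun a b ↦ by
      change (derivationLiftHom M L D (a * b)).snd =
        a • (derivationLiftHom M L D b).snd + b • (derivationLiftHom M L D a).snd
      rw [map_mul, DualNumber.snd_mul, fst_derivationLiftHom, fst_derivationLiftHom, smul_eq_mul, smul_eq_mul]
      ring

/-- `locLift D (a/1) = (D a)/1`. [folklore] -/
theorem Derivation.locLift_algebraMap (D : Derivation ℤ A A) (a : A) :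
    Derivation.locLift M L D (algebraMap A L a) = algebraMap A L (D a) := by
  change (derivationLiftHom M L D (algebraMap A L a)).snd = _
  rw [derivationLiftHom_algebraMap]
  change (inl (algebraMap A L a) + inr (algebraMap A L (D a)) : L[ε]).snd = _
  rw [snd_add, snd_inl, snd_inr, zero_add]

/-- The ring map `z ↦ z + ε·E z : L → L[ε]` attached to a derivation `E` of `L`. [folklore] -/
noncomputable def Derivation.toDualHom (E : Derivation ℤ L L) : L →+* L[ε] where
  toFun z := inl z + inr (E z)
  map_one' := by
    ext
    · simp
    · simp
  map_mul' a b := by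
    ext
    · simp [fst_add, fst_mul]
    · simp only [Derivation.leibniz, smul_eq_mul, snd_add, snd_inl, snd_inr, zero_add, DualNumber.snd_mul, fst_add,
        fst_inl, fst_inr, add_zero]
      ring
  map_zero' := by
    ext
    · simp
    · simp
  map_add' a b := by
    ext
    · simp [fst_add]
    · simp only [map_add, snd_add, snd_inl, snd_inr, zero_add]

include M in
/-- **UNIQUENESS: two derivations of `L` that agree on `A` are equal** (their dual-number ring maps agree on `A`,
hence on the localisation `L`). [folklore] -/
theorem Derivation.eq_of_algebraMap {E E' : Derivation ℤ L L}
    (h : ∀ a : A, E (algebraMap A L a) = E' (algebraMap A L a)) : E = E' := by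
  have key : Derivation.toDualHom L E = Derivation.toDualHom L E' := by
    refine IsLocalization.ringHom_ext M (RingHom.ext fun a ↦ ?_)
    change (inl (algebraMap A L a) + inr (E (algebraMap A L a)) : L[ε]) =
      inl (algebraMap A L a) + inr (E' (algebraMap A L a))
    rw [h]
  ext z
  have hz := DFunLike.congr_fun key z
  change (inl z + inr (E z) : L[ε]) = inl z + inr (E' z) at hz
  simpa using congrArg TrivSqZeroExt.snd hz

/-- In particular a derivation of `L` extending `D` IS `locLift D`. [folklore] -/
theorem Derivation.eq_locLift {D : Derivation ℤ A A} {E : Derivation ℤ L L}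
    (h : ∀ a : A, algebraMap A L (D a) = E (algebraMap A L a)) : E = Derivation.locLift M L D :=
  Derivation.eq_of_algebraMap M L fun a ↦ by rw [← h, Derivation.locLift_algebraMap]

/-- **Transport of a derivation along a ring automorphism** `ψ`: `ψ_* E := ψ ∘ E ∘ ψ⁻¹`. [folklore] -/
noncomputable def Derivation.conjRingEquiv (ψ : L ≃+* L) (E : Derivation ℤ L L) : Derivation ℤ L L :=
  Derivation.mk'
    { toFun := fun z ↦ ψ (E (ψ.symm z))
      map_add' := fun z w ↦ by simp only [map_add]
      map_smul' := fun n z ↦ by simp only [map_zsmul, RingHom.id_apply] }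
    fun a b ↦ by
      change ψ (E (ψ.symm (a * b))) = a • ψ (E (ψ.symm b)) + b • ψ (E (ψ.symm a))
      rw [map_mul, Derivation.leibniz, smul_eq_mul, smul_eq_mul, map_add, map_mul, map_mul, RingEquiv.apply_symm_apply,
        RingEquiv.apply_symm_apply, smul_eq_mul, smul_eq_mul]

/-- `(ψ_* E) (ψ z) = ψ (E z)`. [folklore] -/
theorem Derivation.conjRingEquiv_apply_apply (ψ : L ≃+* L) (E : Derivation ℤ L L) (z : L) :
    Derivation.conjRingEquiv L ψ E (ψ z) = ψ (E z) := by
  change ψ (E (ψ.symm (ψ z))) = _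
  rw [RingEquiv.symm_apply_apply]

/-- `(ψ_* E) z = ψ (E (ψ⁻¹ z))`. [folklore] -/
theorem Derivation.conjRingEquiv_apply (ψ : L ≃+* L) (E : Derivation ℤ L L) (z : L) :
    Derivation.conjRingEquiv L ψ E z = ψ (E (ψ.symm z)) := rfl

/-- `ψ_* (ψ⁻¹_* E) = E`. [folklore] -/
theorem Derivation.conjRingEquiv_conjRingEquiv_symm (ψ : L ≃+* L) (E : Derivation ℤ L L) :
    Derivation.conjRingEquiv L ψ (Derivation.conjRingEquiv L ψ.symm E) = E := by
  ext z
  rw [Derivation.conjRingEquiv_apply, Derivation.conjRingEquiv_apply, RingEquiv.symm_symm,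
    RingEquiv.apply_symm_apply, RingEquiv.apply_symm_apply]

include M in
/-- **Chart-wise uniqueness along a re-coordinatised localisation**: a derivation `E` of `L` extending `D` along
`ψ ∘ (A → L)` (`E (ψ (a/1)) = ψ ((D a)/1)`) IS `ψ_* (locLift D)` (conjugate `Derivation.eq_locLift` by `ψ`).
[folklore] -/
theorem Derivation.eq_conjRingEquiv_locLift (ψ : L ≃+* L) {D : Derivation ℤ A A} {E : Derivation ℤ L L}
    (h : ∀ a : A, ψ (algebraMap A L (D a)) = E (ψ (algebraMap A L a))) :
    E = Derivation.conjRingEquiv L ψ (Derivation.locLift M L D) := by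
  have h' : Derivation.conjRingEquiv L ψ.symm E = Derivation.locLift M L D :=
    Derivation.eq_locLift M L fun a ↦ by
      rw [Derivation.conjRingEquiv_apply, RingEquiv.symm_symm, ← h, RingEquiv.symm_apply_apply]
  rw [← h', Derivation.conjRingEquiv_conjRingEquiv_symm]

end LocLift

/-! ### §2 The doubled plane: the shear is not a coboundary of chart vector fields (extensions computed) -/

namespace DoubledLine

open MvPolynomial

variable (k : Type u) [CommRing k] [Nontrivial k]

/-- **`s⁻¹∂/∂p` is not `D₀ − D₁` on `k[s,s⁻¹,p]` for ANY vector fields `D₀, D₁` on `k[s,p]`** (extensions by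
`Derivation.locLift`; contrapositive of `…KSCoboundary.thetaFamily_not_ksCoboundary_doubledLine`).
[cite: Hartshorne2010, §5 Ex. 5.2] -/
theorem thetaFamily_not_liftCoboundary_doubledLine :
    ¬ ∃ D : Fin 2 → DerZ (A k), ∀ α β,
      Derivation.locLift (Submonoid.powers (X 0 : A k)) (L k) (D α) =
        Derivation.locLift (Submonoid.powers (X 0 : A k)) (L k) (D β) + thetaFamily k α β := by
  rintro ⟨D, hD⟩
  exact thetaFamily_not_ksCoboundary_doubledLine k
    ⟨D, fun α ↦ Derivation.locLift (Submonoid.powers (X 0 : A k)) (L k) (D α),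
      fun α a ↦ (Derivation.locLift_algebraMap _ _ (D α) a).symm, hD⟩

/-- **The `(−2)`-curve version with the extensions computed**: there are NO vector fields `D₀` on `k[s,p]` and `D₁`
on `k[t,q]` whose extensions to the overlap — `locLift D₀` along the localisation, `psi_*(locLift D₁)` along
`psi ∘` localisation (`t = s⁻¹`, `q = s²p`) — satisfy `E_α = E_β + θ_αβ`; i.e. the smoothing direction of the
`A₁`-singularity is NON-ZERO in `Ȟ¹` of the tangent sheaf for the two-chart cover of `𝒪_{ℙ¹}(−2)`.
[cite: Hartshorne2010, §5 Ex. 5.2] -/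
theorem thetaFamily_not_liftCoboundary_minusTwo :
    ¬ ∃ D : Fin 2 → DerZ (A k), ∀ α β,
      (![Derivation.locLift (Submonoid.powers (X 0 : A k)) (L k) (D 0),
          Derivation.conjRingEquiv (L k) (psi k) (Derivation.locLift (Submonoid.powers (X 0 : A k)) (L k) (D 1))] α :
          DerZ (L k)) =
        ![Derivation.locLift (Submonoid.powers (X 0 : A k)) (L k) (D 0),
          Derivation.conjRingEquiv (L k) (psi k) (Derivation.locLift (Submonoid.powers (X 0 : A k)) (L k) (D 1))] β +
          thetaFamily k α β := by
  rintro ⟨D, hD⟩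
  refine thetaFamily_not_ksCoboundary_minusTwo k ⟨D, ![Derivation.locLift (Submonoid.powers (X 0 : A k)) (L k) (D 0),
    Derivation.conjRingEquiv (L k) (psi k) (Derivation.locLift (Submonoid.powers (X 0 : A k)) (L k) (D 1))],
    fun α a ↦ ?_, hD⟩
  fin_cases α
  · exact (Derivation.locLift_algebraMap _ _ (D 0) a).symm
  · show resM2 k 1 (D 1 a) = Derivation.conjRingEquiv (L k) (psi k) _ (resM2 k 1 a)
    rw [resM2_one, RingHom.comp_apply, RingHom.comp_apply, RingHom.coe_coe, Derivation.conjRingEquiv_apply_apply,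
      Derivation.locLift_algebraMap]

end DoubledLine

end EmbeddedDeformation

end Summit.Ventures.HSemireg
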